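import Summits.Parity.GeneralizedHardyLittlewood.Theorems.LiouvilleShiftedTablesEngineToPairsSieveFlatSplit

/-!
# Correlation sieve for line `Sketch` of the crux `EngineToPairs` (stmt-Parity-14659), part 7c:
# the bound for a tuple with two high smooth factors

Support file for the stub `stub_sieve : CorrelationSieveFamily`, continuing part 7b.

* `tuple_bound_two` — for `Large δ x`, `j ∈ {1,2,3}`, `s ≠ t` in `L`, smooth,
  `t` a `ζ` index (left unboxed), and any box-tuple `κ` for the other factors:
  `∑_q |corrFun (w q) x ((∏_{i ≠ t} gF i) ⋆ selF t)| ≤ 4 (log x)² (TI + TII + TI2)`.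
  Proof: `s` in a unit box kills the product; discard unit boxes; if the product vanishes on `(x/2, x]`
  done; else a factorisation `a b = n₀` (`b > V`) bounds the genuine boxed part by `a < x^{11/20}`; the
  subset-sum dichotomy on the small exponents (genuine boxes other than `s`): a window sum ⇒ Type II
  (`typeII_dispatch`, the free `t` inside the smooth group); a small exponent `> 1/3 + 9δ/10` contradicts
  `a < x^{11/20}` (with `lo_s > V/2`); otherwise the rough part is `< 16 x^{3δ/5}` and `flat_split_bound`
  finishes.
-/

noncomputable section

namespace Summit.Parity.GeneralizedHardyLittlewood.Theorems.EngineToPairs.Sieve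

open Finset Real
open scoped ArithmeticFunction.zeta ArithmeticFunction.Moebius ArithmeticFunction.sigma
open Literature.NumberTheory.Sieve Literature.NumberTheory.Sieve.BFI

set_option maxHeartbeats 1600000 in
/-- **A tuple with two high smooth factors is Type II, Type I or Type I₂.** [this line] -/
theorem tuple_bound_two {δ x : ℝ} (hLx : Large δ x) (hδ : 0 < δ) (hδ' : δ ≤ 1 / 100)
    {Qs : Finset ℕ} {w : ℕ → ℕ → ℝ} {TI TII TI2 : ℝ} (hTI : 0 ≤ TI) (hTII : 0 ≤ TII) (hTI2 : 0 ≤ TI2)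
    (hfamI : TypeIFam Qs w x (1 / 2 - 2 * δ) 6 TI) (hfamII : TypeIIFam Qs w x (δ / 2) (1 / 3 + δ / 2) 6 TII)
    (hfamI2 : TypeI2Fam Qs w x δ (3 * δ) 6 TI2)
    {U j : ℕ} (hj : 1 ≤ j) (hj3 : j ≤ 3)
    (L : Finset (Fin (2 * j))) {s t : Fin (2 * j)} (hst : s ≠ t) (hsL : s ∈ L) (htL : t ∈ L)
    (hs1 : j ≤ s.val) (ht1 : j ≤ t.val) (ht2 : t.val ≠ 2 * j - 1) (κ : Fin (2 * j) → ℕ) :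
    ∑ q ∈ Qs, |corrFun (w q) x (fun n =>
      ((∏ i ∈ univ.erase t, gF x U j L κ i) * selF (x ^ ((9 : ℝ) / 20)) U j L t) n)| ≤
      4 * Real.log x ^ 2 * (TI + TII + TI2) := by
  classical
  have hx1 : 1 ≤ x := hLx.one_lt.le
  have hx0 : 0 < x := hLx.pos
  have hxlt : 1 < x := hLx.one_lt
  have hlog1 : 1 ≤ Real.log x := hLx.one_le_log
  have hlog0 : 0 < Real.log x := hLx.log_pos
  have hsq0 : 0 ≤ Real.log x ^ 2 := sq_nonneg _
  have hRHS : 0 ≤ 4 * Real.log x ^ 2 * (TI + TII + TI2) := by positivity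
  set V : ℝ := x ^ ((9 : ℝ) / 20) with hV
  have hV0 : 0 ≤ V := Real.rpow_nonneg hx0.le _
  have hV1 : 1 ≤ V := Real.one_le_rpow hx1 (by norm_num)
  have hVpos : 0 < V := by linarith
  set T := selF V U j L t with hT
  have hTapp : ∀ n, T n = if V < (n : ℝ) then 1 else 0 := fun n => selF_high_zeta_apply hV0 ht1 ht2 htL n
  have hTb : ∀ n, |T n| ≤ 1 := fun n => by rw [hTapp n]; split_ifs <;> simp
  set g : Fin (2 * j) → ArithmeticFunction ℝ := fun i => gF x U j L κ i with hg
  set lo : Fin (2 * j) → ℝ := fun i => boxLow x 1 (κ i) with hlo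
  have hlo0 : ∀ i, 0 < lo i := fun i => boxLow_pos hx0 (by norm_num) (κ i)
  have hcardι : Fintype.card (Fin (2 * j)) ≤ 6 := by rw [Fintype.card_fin]; omega
  set I := (univ : Finset (Fin (2 * j))).erase t with hI
  have hsI : s ∈ I := Finset.mem_erase.2 ⟨hst, Finset.mem_univ s⟩
  have hIcard : I.card ≤ 5 := by
    rw [hI, Finset.card_erase_of_mem (Finset.mem_univ t), Finset.card_univ]; omega
  -- Step 0: `s` in a unit box kills everything
  by_cases hslo : (1 : ℝ) ≤ lo s
  swap
  · have hgs : g s = 0 := by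
      ext n; exact gF_eq_zero_of_high_of_boxLow_lt_one hs1 hsL hV1 hV (not_le.1 hslo) n
    refine le_of_eq_of_le (Finset.sum_eq_zero fun q _ => ?_) hRHS
    rw [abs_eq_zero]
    refine Finset.sum_eq_zero fun n _ => ?_
    dsimp only
    rw [Finset.prod_eq_zero hsI hgs, zero_mul, ArithmeticFunction.zero_apply, zero_mul]
  -- Step 1: discard the unit boxes
  have hunits := corrFun_prod_mul_units_le I Qs w x κ (fun i => selF V U j L i) T
    (fun i _ => abs_box_selF_one_le x V U j L i (κ i))
  refine hunits.trans ?_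
  set Gen := I.filter (fun i => (1 : ℝ) ≤ boxLow x 1 (κ i)) with hGen
  change ∑ q ∈ Qs, |corrFun (w q) x (fun n => ((∏ i ∈ Gen, g i) * T) n)| ≤ _
  have hGenI : Gen ⊆ I := Finset.filter_subset _ _
  have hGenlo : ∀ i ∈ Gen, 1 ≤ lo i := fun i hi => (Finset.mem_filter.1 hi).2
  have hsGen : s ∈ Gen := Finset.mem_filter.2 ⟨hsI, hslo⟩
  have hGencard : Gen.card ≤ 5 := (Finset.card_le_card hGenI).trans hIcard
  have htGen : t ∉ Gen := fun h => by have := hGenI h; rw [hI] at this; exact (Finset.mem_erase.1 this).1 rfl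
  -- Step 2: vanishing case
  by_cases hex : ∃ n ∈ Ioc ⌊x / 2⌋₊ ⌊x⌋₊, ((∏ i ∈ Gen, g i) * T) n ≠ 0
  swap
  · push Not at hex
    refine le_of_eq_of_le (Finset.sum_eq_zero fun q _ => ?_) hRHS
    rw [abs_eq_zero]
    exact Finset.sum_eq_zero fun n hn => by dsimp only; rw [hex n hn, zero_mul]
  obtain ⟨n₀, hn₀, hne⟩ := hex
  have hn₀x : (n₀ : ℝ) ≤ x := (natLe_floor_iff hx0.le).1 (Finset.mem_Ioc.1 hn₀).2
  obtain ⟨a, b, hab, hFa, hTb0⟩ := exists_pair_of_mul_apply_ne_zero hne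
  have hbV : V < b := by rw [hTapp b] at hTb0; by_contra h; exact hTb0 (if_neg h)
  have hb0 : (0 : ℝ) < b := lt_of_le_of_lt hV0 hbV
  set X' : ℝ := ∏ i ∈ Gen, lo i with hX'
  obtain ⟨hX'lt, hX'ge⟩ := prod_gF_support L κ hx0 ⟨s, hsGen⟩ hFa
  have hX'pos : 0 < X' := Finset.prod_pos fun i _ => hlo0 i
  have haX : (a : ℝ) < x / V := by
    rw [lt_div_iff₀ hVpos]
    have h1 : (a : ℝ) * V < a * b := by
      have ha0 : (0 : ℝ) < a := by
        have : 0 < a := Nat.pos_of_ne_zero fun h => by rw [h] at hFa; exact hFa (by simp)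
        exact_mod_cast this
      exact mul_lt_mul_of_pos_left hbV ha0
    have h2 : (a : ℝ) * b = n₀ := by rw [← hab]; push_cast; ring
    linarith
  have hxV : x / V = x ^ ((11 : ℝ) / 20) := by
    rw [hV, div_eq_iff hVpos.ne', ← Real.rpow_add hx0]; norm_num
  have hX'11 : X' < x ^ ((11 : ℝ) / 20) := by rw [← hxV]; exact hX'lt.trans haX
  -- exponents
  set e : Fin (2 * j) → ℝ := fun i => Real.log (lo i) / Real.log x with he
  have he_rpow : ∀ i, x ^ e i = lo i := fun i => rpow_log_div_log hxlt (hlo0 i)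
  have he_nn : ∀ i ∈ Gen, 0 ≤ e i := fun i hi => log_div_log_nonneg hxlt (hGenlo i hi)
  have hprod_e : ∀ S : Finset (Fin (2 * j)), ∏ i ∈ S, lo i = x ^ (∑ i ∈ S, e i) := fun S =>
    prod_eq_rpow_sum_log_div S hxlt lo (fun i _ => hlo0 i)
  -- every genuine factor is non-zero at some `d ∣ a`; in particular `lo_s > V/2`
  have hfac : ∀ i ∈ Gen, ∃ d : ℕ, d ∣ a ∧ g i d ≠ 0 := exists_ne_zero_of_prod_apply_ne_zero Gen hFa
  have hVlos : V < 2 * lo s := by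
    obtain ⟨d, -, hd⟩ := hfac s hsGen
    have h2 : (d : ℝ) ≤ 2 * lo s := (gF_support L κ hd).2
    have hVd : V < d := lt_of_selF_ne_zero_of_mem (mem_smoothIdx.2 hs1) hsL (boxRestrict_ne_zero hd).2
    linarith
  -- the small family
  set small := Gen.erase s with hsmall
  have hsmallGen : small ⊆ Gen := Finset.erase_subset s Gen
  have hsmallcard : small.card ≤ 4 := by rw [hsmall, Finset.card_erase_of_mem hsGen]; omega
  set f : Fin (2 * j) → ℝ := fun i => if i ∈ small then e i else 0 with hf
  have hf_nn : ∀ i, 0 ≤ f i := fun i => by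
    simp only [hf]; split_ifs with h; exacts [he_nn i (hsmallGen h), le_rfl]
  -- the functional at the genuine product, unfolded
  have hcorr : ∀ q, corrFun (w q) x (fun n => ((∏ i ∈ Gen, g i) * T) n) =
      ∑ n ∈ Ioc ⌊x / 2⌋₊ ⌊x⌋₊, ((∏ i ∈ Gen, g i) * T) n * w q n := fun q => rfl
  rcases Literature.NumberTheory.Sieve.BFI.exists_subsum_mem_Icc_or f (a := 3 * δ / 5) (b := 1 / 3 + 9 * δ / 10)
      (by positivity) (by linarith) with ⟨S₀, hs1', hs2'⟩ | ⟨hsm, hbg⟩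
  · ---------------------------------------------------------------- (A) Type II
    set S := S₀.filter (fun i => i ∈ small) with hS
    have hSsub : S ⊆ small := fun i hi => (Finset.mem_filter.1 hi).2
    have hSGen : S ⊆ Gen := hSsub.trans hsmallGen
    have hSsum : ∑ i ∈ S, e i = ∑ i ∈ S₀, f i := by rw [hS, Finset.sum_filter]
    rw [← hSsum] at hs1' hs2'
    have hSne : S.Nonempty := by
      by_contra h; rw [Finset.not_nonempty_iff_eq_empty] at h
      rw [h, Finset.sum_empty] at hs1'; linarith
    have hScard : S.card ≤ 5 := (Finset.card_le_card hSGen).trans hGencard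
    set α := ∏ i ∈ S, g i with hα
    set β := (∏ i ∈ Gen \ S, g i) * T with hβ
    have heq : (∏ i ∈ Gen, g i) * T = α * β := by
      rw [hα, hβ, ← mul_assoc, ← Finset.prod_sdiff hSGen, mul_comm (∏ i ∈ Gen \ S, g i)]
    have hbound := typeII_dispatch hfamII hx1 (by linarith) α β hlog0 hlog0 ?_
      (fun m => abs_prod_gF_le hLx hj L κ S (by omega) m)
      (fun n => abs_prod_gF_mul_le hLx hj L κ (Gen \ S) ((Finset.card_le_card Finset.sdiff_subset).trans hGencard) T hTb n)
    · calc ∑ q ∈ Qs, |corrFun (w q) x (fun n => ((∏ i ∈ Gen, g i) * T) n)|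
          = ∑ q ∈ Qs, |∑ n ∈ Ioc ⌊x / 2⌋₊ ⌊x⌋₊, (α * β) n * w q n| :=
            Finset.sum_congr rfl fun q _ => by rw [hcorr q, heq]
        _ ≤ Real.log x * Real.log x * TII := hbound
        _ ≤ 4 * Real.log x ^ 2 * (TI + TII + TI2) := by
            have e : 4 * Real.log x ^ 2 * (TI + TII + TI2) - Real.log x * Real.log x * TII =
                Real.log x ^ 2 * (4 * TI + 3 * TII + 4 * TI2) := by ring
            have : 0 ≤ Real.log x ^ 2 * (4 * TI + 3 * TII + 4 * TI2) := mul_nonneg hsq0 (by linarith)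
            linarith
    intro m hm
    obtain ⟨hlow, hup⟩ := prod_gF_support L κ hx0 hSne hm
    rw [hprod_e S] at hlow hup
    constructor
    · calc (x / 2) ^ (δ / 2) ≤ x ^ (δ / 2) := Real.rpow_le_rpow (by positivity) (by linarith) (by linarith)
        _ ≤ x ^ (∑ i ∈ S, e i) := Real.rpow_le_rpow_of_exponent_le hx1 (by linarith)
        _ < m := hlow
    · have h2S : (2 : ℝ) ^ S.card ≤ 64 := by
        calc (2 : ℝ) ^ S.card ≤ 2 ^ 6 := pow_le_pow_right₀ (by norm_num) (by omega)
          _ = 64 := by norm_num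
      calc (m : ℝ) ≤ 2 ^ S.card * x ^ (∑ i ∈ S, e i) := hup
        _ ≤ 64 * x ^ (1 / 3 + 9 * δ / 10) := mul_le_mul h2S (Real.rpow_le_rpow_of_exponent_le hx1 hs2')
            (Real.rpow_nonneg hx0.le _) (by norm_num)
        _ ≤ x ^ (1 / 3 + 9 * δ / 10 + δ / 10) := hLx.sixtyfour_mul_rpow_le _
        _ = x ^ (δ / 2 + (1 / 3 + δ / 2)) := by ring_nf
  · ---------------------------------------------------------------- (B)
    by_cases hB2 : ∃ i ∈ small, 3 * δ / 5 ≤ e i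
    · -------------------------------------------------------------- (B2) impossible
      exfalso
      obtain ⟨i, hismall, hei⟩ := hB2
      have hfi : f i = e i := by simp only [hf, hismall, if_true]
      have hbig : 1 / 3 + 9 * δ / 10 < e i := by have := hbg i (by rw [hfi]; exact hei); rwa [hfi] at this
      have hiGen : i ∈ Gen := hsmallGen hismall
      have his : i ≠ s := Finset.ne_of_mem_erase hismall
      -- `X' ≥ lo_i · lo_s`
      have hrest1 : ∀ k ∈ (Gen.erase s).erase i, (1 : ℝ) ≤ lo k := fun k hk =>
        hGenlo k (Finset.erase_subset s Gen (Finset.erase_subset i _ hk))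
      have hX'ge2 : lo i * lo s ≤ X' := by
        have e1 : X' = (∏ k ∈ Gen.erase s, lo k) * lo s := (Finset.prod_erase_mul Gen lo hsGen).symm
        have e2 : ∏ k ∈ Gen.erase s, lo k = (∏ k ∈ (Gen.erase s).erase i, lo k) * lo i :=
          (Finset.prod_erase_mul _ lo hismall).symm
        have h1 : (1 : ℝ) ≤ ∏ k ∈ (Gen.erase s).erase i, lo k := by
          have := Finset.prod_le_prod (s := (Gen.erase s).erase i) (f := fun _ => (1 : ℝ)) (g := lo)
            (fun _ _ => zero_le_one) (fun k hk => hrest1 k hk)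
          simpa using this
        rw [e1, e2]
        have hli : 0 ≤ lo i := (hlo0 i).le
        have hls : 0 ≤ lo s := (hlo0 s).le
        calc lo i * lo s = 1 * lo i * lo s := by ring
          _ ≤ (∏ k ∈ (Gen.erase s).erase i, lo k) * lo i * lo s :=
              mul_le_mul_of_nonneg_right (mul_le_mul_of_nonneg_right h1 hli) hls
      -- `lo_i > x^{1/3+9δ/10}`, `lo_s > V/2`: so `X' > x^{1/3+9δ/10} V / 2`, against `X' < x^{11/20}`
      have hloi : x ^ (1 / 3 + 9 * δ / 10) < lo i := by rw [← he_rpow]; exact Real.rpow_lt_rpow_of_exponent_lt hxlt hbig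
      have hkey : x ^ (1 / 3 + 9 * δ / 10) * V < 2 * x ^ ((11 : ℝ) / 20) := by nlinarith [hlo0 i, hlo0 s]
      -- but `x^{1/3+9δ/10} · V = x^{11/20} · x^{7/30 + 9δ/10}` and `x^{7/30+9δ/10} ≥ x^{δ/10} ≥ 64`
      have e : x ^ (1 / 3 + 9 * δ / 10) * V = x ^ ((11 : ℝ) / 20) * x ^ ((7 : ℝ) / 30 + 9 * δ / 10) := by
        rw [hV, ← Real.rpow_add hx0, ← Real.rpow_add hx0]; congr 1; ring
      have h64 : (64 : ℝ) ≤ x ^ ((7 : ℝ) / 30 + 9 * δ / 10) :=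
        hLx.rpow_tenth.trans (Real.rpow_le_rpow_of_exponent_le hx1 (by linarith))
      have h11 : 0 < x ^ ((11 : ℝ) / 20) := Real.rpow_pos_of_pos hx0 _
      rw [e] at hkey
      nlinarith
    · -------------------------------------------------------------- (B1) flat split
      push Not at hB2
      have hsumsmall : ∑ i ∈ small, e i < 3 * δ / 5 := by
        have h1 : ∑ i ∈ small, e i = ∑ i ∈ small, f i :=
          Finset.sum_congr rfl fun i hi => by simp only [hf, hi, if_true]
        have h2 : ∑ i ∈ small, f i ≤ ∑ i ∈ univ.filter (fun i => f i < 3 * δ / 5), f i := by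
          apply Finset.sum_le_sum_of_subset_of_nonneg
          · intro i hi
            refine Finset.mem_filter.2 ⟨Finset.mem_univ _, ?_⟩
            simp only [hf, hi, if_true]; exact hB2 i hi
          · intro i _ _; exact hf_nn i
        linarith
      set α := ∏ i ∈ small, g i with hα
      have heqP : (∏ i ∈ Gen, g i) * T = α * g s * T := by rw [hα, Finset.prod_erase_mul Gen g hsGen]
      -- the rough part: support and coefficients
      have hαR : ∀ r, α r ≠ 0 → (r : ℝ) ≤ 16 * x ^ (3 * δ / 5) := by
        intro r hr
        rcases small.eq_empty_or_nonempty with hE | hE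
        · rw [hα, hE, Finset.prod_empty, ArithmeticFunction.one_apply] at hr
          have : r = 1 := by by_contra h; exact hr (if_neg h)
          subst this
          have : 1 ≤ x ^ (3 * δ / 5) := Real.one_le_rpow hx1 (by positivity)
          rw [Nat.cast_one]; linarith
        obtain ⟨-, hup⟩ := prod_gF_support L κ hx0 hE hr
        rw [hprod_e small] at hup
        have h2 : (2 : ℝ) ^ small.card ≤ 16 := by
          calc (2 : ℝ) ^ small.card ≤ 2 ^ 4 := pow_le_pow_right₀ (by norm_num) hsmallcard
            _ = 16 := by norm_num
        calc (r : ℝ) ≤ 2 ^ small.card * x ^ (∑ i ∈ small, e i) := hup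
          _ ≤ 16 * x ^ (3 * δ / 5) := mul_le_mul h2 (Real.rpow_le_rpow_of_exponent_le hx1 hsumsmall.le)
              (Real.rpow_nonneg hx0.le _) (by norm_num)
      have hαb : ∀ r, |α r| ≤ Real.log x * ((σ 0 r : ℕ) : ℝ) ^ 4 := by
        intro r
        rcases Nat.eq_zero_or_pos r with rfl | hr
        · simp only [ArithmeticFunction.map_zero, abs_zero]; positivity
        set A : Fin (2 * j) → ℝ := fun i => if i.val = 2 * j - 1 then Real.log x else 1 with hA
        have hA1 : ∀ i ∈ small, 1 ≤ A i := fun i _ => by simp only [hA]; split_ifs <;> [exact hlog1; exact le_rfl]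
        have h1 := abs_prod_apply_le_of_abs_le small g A hA1 (fun i _ n => abs_gF_le hLx hj L κ i n) r
        have hprodA : ∏ i ∈ small, A i ≤ Real.log x := by
          by_cases hmem : ∃ i ∈ small, i.val = 2 * j - 1
          · obtain ⟨i₀, hi₀, hi₀v⟩ := hmem
            rw [← Finset.mul_prod_erase small A hi₀]
            have hrest : ∏ i ∈ small.erase i₀, A i = 1 := by
              refine Finset.prod_eq_one fun i hi => ?_
              have hne : i ≠ i₀ := Finset.ne_of_mem_erase hi
              have : i.val ≠ 2 * j - 1 := fun h => hne (Fin.ext (by rw [h, hi₀v]))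
              simp [hA, this]
            rw [hrest, mul_one]; simp [hA, hi₀v]
          · push Not at hmem
            rw [Finset.prod_eq_one (fun i hi => by simp [hA, hmem i hi])]; exact hlog1
        have hσ1 : (1 : ℝ) ≤ ((σ 0 r : ℕ) : ℝ) := by
          have : 1 ≤ σ 0 r := by
            rw [ArithmeticFunction.sigma_zero_apply]
            exact Finset.card_pos.2 ⟨1, Nat.one_mem_divisors.2 hr.ne'⟩
          exact_mod_cast this
        calc |α r| ≤ (∏ i ∈ small, A i) * ((σ 0 r : ℕ) : ℝ) ^ small.card := h1
          _ ≤ Real.log x * ((σ 0 r : ℕ) : ℝ) ^ 4 :=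
              mul_le_mul hprodA (pow_le_pow_right₀ hσ1 hsmallcard) (by positivity) hlog0.le
      -- the flat factor `g s`
      have hlosx : 2 * lo s ≤ x := by
        have := boxHigh_le hx0.le (κ s); rwa [boxHigh_eq_two_mul_boxLow] at this
      have hbound : ∑ q ∈ Qs, |∑ n ∈ Ioc ⌊x / 2⌋₊ ⌊x⌋₊, (α * g s * T) n * w q n| ≤
          4 * Real.log x ^ 2 * (TI + TI2) := by
        by_cases hsℓ : s.val = 2 * j - 1
        · refine flat_split_bound hLx hδ hδ' hTI hTI2 hfamI hfamI2 α (g s) T hαR hαb hslo hlosx hVlos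
            (fun n : ℕ => Real.log (n : ℝ)) (Or.inr rfl) (fun n => ?_) hTapp
          have := box_selF_log_high_apply (U := U) hx0 hV0 hj hsℓ hsL (κ s) n
          rw [boxHigh_eq_two_mul_boxLow] at this
          exact this
        · refine flat_split_bound hLx hδ hδ' hTI hTI2 hfamI hfamI2 α (g s) T hαR hαb hslo hlosx hVlos
            (fun _ => (1 : ℝ)) (Or.inl rfl) (fun n => ?_) hTapp
          have := box_selF_zeta_high_apply (U := U) hx0 hV0 hs1 hsℓ hsL (κ s) n
          rw [boxHigh_eq_two_mul_boxLow] at this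
          exact this
      calc ∑ q ∈ Qs, |corrFun (w q) x (fun n => ((∏ i ∈ Gen, g i) * T) n)|
          = ∑ q ∈ Qs, |∑ n ∈ Ioc ⌊x / 2⌋₊ ⌊x⌋₊, (α * g s * T) n * w q n| :=
            Finset.sum_congr rfl fun q _ => by rw [hcorr q, heqP]
        _ ≤ 4 * Real.log x ^ 2 * (TI + TI2) := hbound
        _ ≤ 4 * Real.log x ^ 2 * (TI + TII + TI2) := by nlinarith

end Summit.Parity.GeneralizedHardyLittlewood.Theorems.EngineToPairs.Sieve

namespace Summit.Parity.GeneralizedHardyLittlewood.Theorems.EngineToPairs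

/-- Registered sub-goal of `stub_sieve` carried by this part (landing mechanics): `x / x^{9/20} = x^{11/20}`
for `x > 0`. [folklore] -/
theorem sieve_part7c_anchor : ∀ (x : ℝ), 0 < x → x / x ^ ((9 : ℝ) / 20) = x ^ ((11 : ℝ) / 20) := by
  intro x hx
  rw [div_eq_iff (Real.rpow_pos_of_pos hx _).ne', ← Real.rpow_add hx]; norm_num

end Summit.Parity.GeneralizedHardyLittlewood.Theorems.EngineToPairs

end
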